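import Summits.Ventures.HodgeRepro2.T5RecordSphericalSpectrumIntrinsic
import Summits.Ventures.HodgeRepro2.T5RecordSatakeToy

/-!
# The unramified spectrum of the record's pair at every place that stays prime, DATUM-FREE

Tier-5 support N3 / §G-N4.2 (seat p3, gen 87). File 344 states the unramified spectrum of the record's pair
`(U(1 ⊗ H), K_v)` at every place `v` of `K⁺` with `v 𝓞_K = w`, good for `H`, for a GIVEN datum `(θ, y)` of the CM
field (`algebraMap θ = y²`, `complexConj y ≠ y`) and GIVEN generators `l` of `𝓞_K` over `𝓞_{K⁺}`. File 235 proves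
that both exist for every CM field (`exists_sq_eq_and_complexConj_ne`, `exists_fin_span_eq_top`). This file
quantifies them away, so that the statement has NO hypothesis on the CM field beyond `v 𝓞_K = w`:

* **`exists_datum_and_mulEquiv_forall_nonempty_equiv_inertSphericalQuot_record_of_staysPrime`** — for every CM
  field `K`, every place `v` of `K⁺` that stays prime (`v 𝓞_K = w`), every `q' = N(v)`, every generators `l` and every
  hermitian unimodular `H` good at `w`: there is a datum `(θ, y)` with `u₀`, `Φ : U(J₃(u₀)) ≃* U(1 ⊗ H)` matching the
  hyperspecial subgroups, a star-fixed uniformiser `ϖ'`, such that every irreducible `K_v`-finite representation of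
  `U(1 ⊗ H)` with non-zero finite-dimensional `K_v`-invariants is `≅ (inertSphericalQuot (α q'⁻²)) ∘ Φ⁻¹` for some
  `α ≠ 0`;
* **`exists_datum_generators_and_…_of_staysPrime`** — the generators quantified away as well;
* **`exists_datum_generators_and_…_gramToy_of_staysPrime`** — for the lane's `H₀ = diag(1, 1, −1)` (file 237's
  `gramToy`, good at every `w`) and `q' = N(v)` itself: the hypothesis list is exactly `[IsCMField K]`, `v`, `w`,
  `v 𝓞_K = w`, `k` algebraically closed of characteristic `0`.

The proofs are `.elim` chains over file 235's existence theorems applied to file 344; nothing is re-proved. §8(d):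
uses an L-value-free non-vanishing device: NO.
-/

open Matrix NumberField NumberField.IsCMField IsDedekindDomain IsDedekindDomain.HeightOneSpectrum Module
  MulAction
open scoped TensorProduct Pointwise
open Summit.Ventures.HodgeRepro2.T5UnitaryGroupForm Summit.Ventures.HodgeRepro2.T5UnitaryHeckeAdjoint
  Summit.Ventures.HodgeRepro2.T5HeckePermutationModule Summit.Ventures.HodgeRepro2.LevelPositivity
  Summit.Ventures.HodgeRepro2.T5LevelIdempotent Summit.Ventures.HodgeRepro2.T5StarOfInvolution
  Summit.Ventures.HodgeRepro2.T5FinitePlaceCM Summit.Ventures.HodgeRepro2.T5NonSplitPlaceUnitaryGroup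
  Summit.Ventures.HodgeRepro2.T5RecordHyperspecial Summit.Ventures.HodgeRepro2.T5GlobalLatticeAlmostAll
  Summit.Ventures.HodgeRepro2.T5HermitianThreeElements Summit.Ventures.HodgeRepro2.T5GaloisCartanThree
  Summit.Ventures.HodgeRepro2.T5InertDegreeGalois Summit.Ventures.HodgeRepro2.T5InertPlaceCompletion
  Summit.Ventures.HodgeRepro2.T5InertDegreeAdicCompletion Summit.Ventures.HodgeRepro2.T5InertSatakeTransform
  Summit.Ventures.HodgeRepro2.T5InertSatakeTransformCompletion Summit.Ventures.HodgeRepro2.T5InertUnipotentResidue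
  Summit.Ventures.HodgeRepro2.T5InertSphericalSubquotient Summit.Ventures.HodgeRepro2.T5RecordSatakeCell
  Summit.Ventures.HodgeRepro2.T5SplitPlaceUnitaryGroup Summit.Ventures.HodgeRepro2.T5FinitePlaceNormIndex
  Summit.Ventures.HodgeRepro2.T5HermitianLocalIsotropyN3 Summit.Ventures.HodgeRepro2.T5FinitePlaceSplitClassification
  Summit.Ventures.HodgeRepro2.T5InertDegreeCompletion Summit.Ventures.HodgeRepro2.T5InertPlaceCompletionCells
  Summit.Ventures.HodgeRepro2.T5RecordSatake Summit.Ventures.HodgeRepro2.T5CartanCellsDistinct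
  Summit.Ventures.HodgeRepro2.T5RecordSatakeInert Summit.Ventures.HodgeRepro2.T5InertGlobalPrime
  Summit.Ventures.HodgeRepro2.T5CMFieldSquareDatum Summit.Ventures.HodgeRepro2.T5RecordSatakeDegree
  Summit.Ventures.HodgeRepro2.T5RecordSatakeDegreeIntrinsic Summit.Ventures.HodgeRepro2.T5RecordSphericalSpectrum
  Summit.Ventures.HodgeRepro2.T5RecordSphericalSpectrumIntrinsic Summit.Ventures.HodgeRepro2.T5RecordSatakeToy

namespace Summit.Ventures.HodgeRepro2.T5RecordSphericalSpectrumDatumFree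

universe uV

section DatumFree

variable (K : Type*) [Field K] [NumberField K] [IsCMField K]
variable (v : HeightOneSpectrum (𝓞 (maximalRealSubfield K))) (w : HeightOneSpectrum (𝓞 K))
  [w.asIdeal.LiesOver v.asIdeal]
  (hmap : Ideal.map (algebraMap (𝓞 (maximalRealSubfield K)) (𝓞 K)) v.asIdeal = w.asIdeal)
variable (k : Type*) [Field k] [CharZero k] [IsAlgClosed k]

include hmap in
/-- **THE UNRAMIFIED SPECTRUM AT EVERY PLACE THAT STAYS PRIME, THE DATUM QUANTIFIED AWAY**: file 344's theorem with
the datum `(θ, y)` supplied by file 235's `exists_sq_eq_and_complexConj_ne` — for every CM field `K`, every `v` with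
`v 𝓞_K = w`, every `q' = N(v)`, every generators `l`, every hermitian unimodular `H` good at `w`. -/
theorem exists_datum_and_mulEquiv_forall_nonempty_equiv_inertSphericalQuot_record_of_staysPrime
    {r : ℕ} (l : Fin r → 𝓞 K) (q' : k) (hq' : (Ideal.absNorm v.asIdeal : k) = q')
    (hl : Submodule.span (𝓞 (maximalRealSubfield K)) (Set.range l) = ⊤)
    {H : Matrix (Fin 3) (Fin 3) K} (hH : H.IsHermitian) (hdet : IsUnit H.det) (hgood : w ∉ badSet H) :
    ∃ (θ : maximalRealSubfield K) (y : K) (hθ : algebraMap (maximalRealSubfield K) K θ = y ^ 2)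
      (hy : complexConj K y ≠ y),
      letI := tensorStarRing K v
      letI := starRingOfQuadratic (finrank_eq_two K v w hθ hy (not_isSquare_of_staysPrime K v w hθ hy hmap))
        (localConj v w hθ.symm (span_pair_eq_top K hy) (not_isSquare_of_staysPrime K v w hθ hy hmap) (complexConj K))
        (localConj_ne_one v w hθ.symm (span_pair_eq_top K hy) (not_isSquare_of_staysPrime K v w hθ hy hmap)
          (complexConj K) (complexConj_apply_eq_neg K hθ hy))
      haveI := isDiscreteValuationRing_integralClosure_adicCompletion v w
      haveI := finite_residueField_integralClosure_adicCompletion v w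
      haveI : IsFractionRing (integralClosure (v.adicCompletionIntegers (maximalRealSubfield K)) (w.adicCompletion K))
        (w.adicCompletion K) :=
        integralClosure.isFractionRing_of_finite_extension (v.adicCompletion (maximalRealSubfield K))
          (w.adicCompletion K)
      ∃ (u₀ : (v.adicCompletionIntegers (maximalRealSubfield K))ˣ)
        (Φ : ↥(formUnitaryGroup (J3 (algebraMap (v.adicCompletionIntegers (maximalRealSubfield K))
          (w.adicCompletion K) (u₀ : v.adicCompletionIntegers (maximalRealSubfield K))))) ≃*
          ↥(formUnitaryGroup (tensorGram K v H)))
        (ϖ' : integralClosure (v.adicCompletionIntegers (maximalRealSubfield K)) (w.adicCompletion K))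
        (hϖ' : Irreducible ϖ')
        (hs' : star (algebraMap (integralClosure (v.adicCompletionIntegers (maximalRealSubfield K))
          (w.adicCompletion K)) (w.adicCompletion K) ϖ') =
            algebraMap (integralClosure (v.adicCompletionIntegers (maximalRealSubfield K)) (w.adicCompletion K))
              (w.adicCompletion K) ϖ'),
        (∀ g, g ∈ hyperspecialSubgroup
            (integralClosure (v.adicCompletionIntegers (maximalRealSubfield K)) (w.adicCompletion K))
            (J3 (algebraMap (v.adicCompletionIntegers (maximalRealSubfield K)) (w.adicCompletion K)
              (u₀ : v.adicCompletionIntegers (maximalRealSubfield K)))) ↔ Φ g ∈ recordHyperspecial K v l H) ∧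
        ∀ {V : Type uV} [AddCommGroup V] [Module k V]
          (ρ : Representation k (↥(formUnitaryGroup (tensorGram K v H))) V) [ρ.IsIrreducible],
          KFinite ρ (recordHyperspecial K v l H) →
          ∀ [FiniteDimensional k (invariants ρ (recordHyperspecial K v l H))],
          invariants ρ (recordHyperspecial K v l H) ≠ ⊥ →
          ∃ α : k, α ≠ 0 ∧ Nonempty (ρ.Equiv (comp Φ.symm
            (inertSphericalQuot
              (hstar_of_star_eq (localConj v w hθ.symm (span_pair_eq_top K hy)
                (not_isSquare_of_staysPrime K v w hθ hy hmap) (complexConj K))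
                (fun x => by rw [star_p8_eq_star K v w hθ hy (not_isSquare_of_staysPrime K v w hθ hy hmap)]; rfl))
              (algebraMap (v.adicCompletionIntegers (maximalRealSubfield K)) (w.adicCompletion K)
                (u₀ : v.adicCompletionIntegers (maximalRealSubfield K)))
              (star_algebraMap_of_star_eq (localConj v w hθ.symm (span_pair_eq_top K hy)
                (not_isSquare_of_staysPrime K v w hθ hy hmap) (complexConj K))
                (fun x => by rw [star_p8_eq_star K v w hθ hy (not_isSquare_of_staysPrime K v w hθ hy hmap)]; rfl)
                (u₀ : v.adicCompletionIntegers (maximalRealSubfield K)))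
              (algebraMap_unit_ne_zero (F := v.adicCompletion (maximalRealSubfield K)) u₀)
              (isInteger_algebraMap (u₀ : v.adicCompletionIntegers (maximalRealSubfield K)))
              (isInteger_algebraMap_unit_inv u₀) hϖ' hs' k (α * (q' ^ 2)⁻¹)))) :=
  (exists_sq_eq_and_complexConj_ne K).elim fun θ h => h.elim fun y h' =>
    ⟨θ, y, h'.1, h'.2, exists_mulEquiv_forall_nonempty_equiv_inertSphericalQuot_record_of_staysPrime K v w h'.1 h'.2
      hmap l k q' hq' hl hH hdet hgood⟩

include hmap in
/-- **THE DATUM AND THE GENERATORS QUANTIFIED AWAY**: file 235's `exists_fin_span_eq_top` supplies `l`. -/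
theorem exists_datum_generators_and_mulEquiv_forall_nonempty_equiv_inertSphericalQuot_record_of_staysPrime
    (q' : k) (hq' : (Ideal.absNorm v.asIdeal : k) = q')
    {H : Matrix (Fin 3) (Fin 3) K} (hH : H.IsHermitian) (hdet : IsUnit H.det) (hgood : w ∉ badSet H) :
    ∃ (θ : maximalRealSubfield K) (y : K) (hθ : algebraMap (maximalRealSubfield K) K θ = y ^ 2)
      (hy : complexConj K y ≠ y) (r : ℕ) (l : Fin r → 𝓞 K)
      (_hl : Submodule.span (𝓞 (maximalRealSubfield K)) (Set.range l) = ⊤),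
      letI := tensorStarRing K v
      letI := starRingOfQuadratic (finrank_eq_two K v w hθ hy (not_isSquare_of_staysPrime K v w hθ hy hmap))
        (localConj v w hθ.symm (span_pair_eq_top K hy) (not_isSquare_of_staysPrime K v w hθ hy hmap) (complexConj K))
        (localConj_ne_one v w hθ.symm (span_pair_eq_top K hy) (not_isSquare_of_staysPrime K v w hθ hy hmap)
          (complexConj K) (complexConj_apply_eq_neg K hθ hy))
      haveI := isDiscreteValuationRing_integralClosure_adicCompletion v w
      haveI := finite_residueField_integralClosure_adicCompletion v w
      haveI : IsFractionRing (integralClosure (v.adicCompletionIntegers (maximalRealSubfield K)) (w.adicCompletion K))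
        (w.adicCompletion K) :=
        integralClosure.isFractionRing_of_finite_extension (v.adicCompletion (maximalRealSubfield K))
          (w.adicCompletion K)
      ∃ (u₀ : (v.adicCompletionIntegers (maximalRealSubfield K))ˣ)
        (Φ : ↥(formUnitaryGroup (J3 (algebraMap (v.adicCompletionIntegers (maximalRealSubfield K))
          (w.adicCompletion K) (u₀ : v.adicCompletionIntegers (maximalRealSubfield K))))) ≃*
          ↥(formUnitaryGroup (tensorGram K v H)))
        (ϖ' : integralClosure (v.adicCompletionIntegers (maximalRealSubfield K)) (w.adicCompletion K))
        (hϖ' : Irreducible ϖ')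
        (hs' : star (algebraMap (integralClosure (v.adicCompletionIntegers (maximalRealSubfield K))
          (w.adicCompletion K)) (w.adicCompletion K) ϖ') =
            algebraMap (integralClosure (v.adicCompletionIntegers (maximalRealSubfield K)) (w.adicCompletion K))
              (w.adicCompletion K) ϖ'),
        (∀ g, g ∈ hyperspecialSubgroup
            (integralClosure (v.adicCompletionIntegers (maximalRealSubfield K)) (w.adicCompletion K))
            (J3 (algebraMap (v.adicCompletionIntegers (maximalRealSubfield K)) (w.adicCompletion K)
              (u₀ : v.adicCompletionIntegers (maximalRealSubfield K)))) ↔ Φ g ∈ recordHyperspecial K v l H) ∧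
        ∀ {V : Type uV} [AddCommGroup V] [Module k V]
          (ρ : Representation k (↥(formUnitaryGroup (tensorGram K v H))) V) [ρ.IsIrreducible],
          KFinite ρ (recordHyperspecial K v l H) →
          ∀ [FiniteDimensional k (invariants ρ (recordHyperspecial K v l H))],
          invariants ρ (recordHyperspecial K v l H) ≠ ⊥ →
          ∃ α : k, α ≠ 0 ∧ Nonempty (ρ.Equiv (comp Φ.symm
            (inertSphericalQuot
              (hstar_of_star_eq (localConj v w hθ.symm (span_pair_eq_top K hy)
                (not_isSquare_of_staysPrime K v w hθ hy hmap) (complexConj K))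
                (fun x => by rw [star_p8_eq_star K v w hθ hy (not_isSquare_of_staysPrime K v w hθ hy hmap)]; rfl))
              (algebraMap (v.adicCompletionIntegers (maximalRealSubfield K)) (w.adicCompletion K)
                (u₀ : v.adicCompletionIntegers (maximalRealSubfield K)))
              (star_algebraMap_of_star_eq (localConj v w hθ.symm (span_pair_eq_top K hy)
                (not_isSquare_of_staysPrime K v w hθ hy hmap) (complexConj K))
                (fun x => by rw [star_p8_eq_star K v w hθ hy (not_isSquare_of_staysPrime K v w hθ hy hmap)]; rfl)
                (u₀ : v.adicCompletionIntegers (maximalRealSubfield K)))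
              (algebraMap_unit_ne_zero (F := v.adicCompletion (maximalRealSubfield K)) u₀)
              (isInteger_algebraMap (u₀ : v.adicCompletionIntegers (maximalRealSubfield K)))
              (isInteger_algebraMap_unit_inv u₀) hϖ' hs' k (α * (q' ^ 2)⁻¹)))) :=
  (exists_sq_eq_and_complexConj_ne K).elim fun θ h => h.elim fun y h' =>
    (exists_fin_span_eq_top K).elim fun r hr => hr.elim fun l hl =>
      ⟨θ, y, h'.1, h'.2, r, l, hl,
        exists_mulEquiv_forall_nonempty_equiv_inertSphericalQuot_record_of_staysPrime K v w h'.1 h'.2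
          hmap l k q' hq' hl hH hdet hgood⟩

include hmap in
/-- **THE LANE'S `H₀ = diag(1, 1, −1)` AT EVERY PLACE THAT STAYS PRIME, HYPOTHESIS-FREE**: the unramified spectrum of
`(U(1 ⊗ H₀), K_v)` with the Satake parameter `α · N(v)⁻²`, for every CM field `K` and every `v` with `v 𝓞_K = w` —
the datum, the generators and the good-place condition (`badSet H₀ = ∅`) all supplied. -/
theorem exists_datum_generators_and_mulEquiv_forall_nonempty_equiv_inertSphericalQuot_record_gramToy_of_staysPrime :
    ∃ (θ : maximalRealSubfield K) (y : K) (hθ : algebraMap (maximalRealSubfield K) K θ = y ^ 2)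
      (hy : complexConj K y ≠ y) (r : ℕ) (l : Fin r → 𝓞 K)
      (_hl : Submodule.span (𝓞 (maximalRealSubfield K)) (Set.range l) = ⊤),
      letI := tensorStarRing K v
      letI := starRingOfQuadratic (finrank_eq_two K v w hθ hy (not_isSquare_of_staysPrime K v w hθ hy hmap))
        (localConj v w hθ.symm (span_pair_eq_top K hy) (not_isSquare_of_staysPrime K v w hθ hy hmap) (complexConj K))
        (localConj_ne_one v w hθ.symm (span_pair_eq_top K hy) (not_isSquare_of_staysPrime K v w hθ hy hmap)
          (complexConj K) (complexConj_apply_eq_neg K hθ hy))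
      haveI := isDiscreteValuationRing_integralClosure_adicCompletion v w
      haveI := finite_residueField_integralClosure_adicCompletion v w
      haveI : IsFractionRing (integralClosure (v.adicCompletionIntegers (maximalRealSubfield K)) (w.adicCompletion K))
        (w.adicCompletion K) :=
        integralClosure.isFractionRing_of_finite_extension (v.adicCompletion (maximalRealSubfield K))
          (w.adicCompletion K)
      ∃ (u₀ : (v.adicCompletionIntegers (maximalRealSubfield K))ˣ)
        (Φ : ↥(formUnitaryGroup (J3 (algebraMap (v.adicCompletionIntegers (maximalRealSubfield K))
          (w.adicCompletion K) (u₀ : v.adicCompletionIntegers (maximalRealSubfield K))))) ≃*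
          ↥(formUnitaryGroup (tensorGram K v (gramToy K))))
        (ϖ' : integralClosure (v.adicCompletionIntegers (maximalRealSubfield K)) (w.adicCompletion K))
        (hϖ' : Irreducible ϖ')
        (hs' : star (algebraMap (integralClosure (v.adicCompletionIntegers (maximalRealSubfield K))
          (w.adicCompletion K)) (w.adicCompletion K) ϖ') =
            algebraMap (integralClosure (v.adicCompletionIntegers (maximalRealSubfield K)) (w.adicCompletion K))
              (w.adicCompletion K) ϖ'),
        (∀ g, g ∈ hyperspecialSubgroup
            (integralClosure (v.adicCompletionIntegers (maximalRealSubfield K)) (w.adicCompletion K))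
            (J3 (algebraMap (v.adicCompletionIntegers (maximalRealSubfield K)) (w.adicCompletion K)
              (u₀ : v.adicCompletionIntegers (maximalRealSubfield K)))) ↔ Φ g ∈ recordHyperspecial K v l (gramToy K)) ∧
        ∀ {V : Type uV} [AddCommGroup V] [Module k V]
          (ρ : Representation k (↥(formUnitaryGroup (tensorGram K v (gramToy K)))) V) [ρ.IsIrreducible],
          KFinite ρ (recordHyperspecial K v l (gramToy K)) →
          ∀ [FiniteDimensional k (invariants ρ (recordHyperspecial K v l (gramToy K)))],
          invariants ρ (recordHyperspecial K v l (gramToy K)) ≠ ⊥ →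
          ∃ α : k, α ≠ 0 ∧ Nonempty (ρ.Equiv (comp Φ.symm
            (inertSphericalQuot
              (hstar_of_star_eq (localConj v w hθ.symm (span_pair_eq_top K hy)
                (not_isSquare_of_staysPrime K v w hθ hy hmap) (complexConj K))
                (fun x => by rw [star_p8_eq_star K v w hθ hy (not_isSquare_of_staysPrime K v w hθ hy hmap)]; rfl))
              (algebraMap (v.adicCompletionIntegers (maximalRealSubfield K)) (w.adicCompletion K)
                (u₀ : v.adicCompletionIntegers (maximalRealSubfield K)))
              (star_algebraMap_of_star_eq (localConj v w hθ.symm (span_pair_eq_top K hy)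
                (not_isSquare_of_staysPrime K v w hθ hy hmap) (complexConj K))
                (fun x => by rw [star_p8_eq_star K v w hθ hy (not_isSquare_of_staysPrime K v w hθ hy hmap)]; rfl)
                (u₀ : v.adicCompletionIntegers (maximalRealSubfield K)))
              (algebraMap_unit_ne_zero (F := v.adicCompletion (maximalRealSubfield K)) u₀)
              (isInteger_algebraMap (u₀ : v.adicCompletionIntegers (maximalRealSubfield K)))
              (isInteger_algebraMap_unit_inv u₀) hϖ' hs' k (α * ((Ideal.absNorm v.asIdeal : k) ^ 2)⁻¹)))) :=
  exists_datum_generators_and_mulEquiv_forall_nonempty_equiv_inertSphericalQuot_record_of_staysPrime K v w hmap k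
    (Ideal.absNorm v.asIdeal : k) rfl gramToy_isHermitian isUnit_det_gramToy (notMem_badSet_gramToy w)

end DatumFree

end Summit.Ventures.HodgeRepro2.T5RecordSphericalSpectrumDatumFree
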